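import Literature.Barriers.NavierStokesRegularity.ComplexNavierStokesBlowupProofs
import Mathlib.MeasureTheory.Integral.Prod
import Mathlib.MeasureTheory.Integral.Bochner.Set
import Mathlib.MeasureTheory.Constructions.BorelSpace.Metrizable
import Mathlib.MeasureTheory.Function.SpecialFunctions.Inner
import Mathlib.Algebra.BigOperators.NatAntidiagonal
import Mathlib.Topology.Algebra.InfiniteSum.Basic
import HarnessLib

/-!
# Li–Sinai complex Navier–Stokes blow-up: the power series solves (1) for all times

Third file of the barrier entry `ComplexNavierStokesBlowup` (D-0021; fact in
`ComplexNavierStokesBlowup.lean`, literal form and Fatou reduction in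
`ComplexNavierStokesBlowupProofs.lean`). It formalises §2 of D. Li, Ya. G. Sinai, *Blow ups of
complex solutions of the 3D Navier–Stokes system and renormalization group method*, J. Eur. Math.
Soc. 10 (2008) 267–313 — the power-series construction on which the whole paper rests — and
PROVES that this series is an honest solution of the integral equation (1), thereby isolating the
unproved core of the barrier as a statement about the ENERGY of one explicit object.

## What is printed (§2, p. 269–270)

With `v_A(k, 0) = A v(k, 0)` the solution of (1) is written as the power series
`v_A(k,t) = e^{-t|k|²} A v(k,0) + ∫₀ᵗ e^{-(t-s)|k|²} Σ_{p>1} A^p g_p(k,s) ds` (3) (= (46), §10),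
whose substitution into (1) gives the recurrent equations (4)–(6) for the `g_p` — sums over
`p₁ + p₂ = p` of the interaction integral `∫ ⟨·(k-k'), k⟩ P_k ·(k') dk'` of lower modes against
heat factors; "Clearly, `g_p(k,s) ⊥ k`"; "the series (3) converges for sufficiently small `s` and
gives a classical solution of (1)" ([S2]); and "if `C = supp v(k,0)` then
`supp g_p = C + ⋯ + C` (`p` times)".

## What is here (all PROVED; vocabulary of `ComplexNavierStokesBlowup.lean`)

* `LiSinai.pairIntegrand F G k s k' = ⟨F(s, k-k'), k⟩ P_k G(s, k')` and the Duhamel pair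
  `LiSinai.duhamelPair F G t k = ∫₀ᵗ e^{-(t-s)|k|²} ∫ pairIntegrand F G k s k' dk' ds`;
* `LiSinai.mode v₀ p` — the `p`-th term of (3) in Duhamel form (amplitude absorbed into the
  datum): `mode v₀ 1 t k = e^{-t|k|²} v₀ k`, `mode v₀ (m+2) = Σ_{i+j=m} duhamelPair (mode (i+1))
  (mode (j+1))`, i.e. `mode v₀ p t k = ∫₀ᵗ e^{-(t-s)|k|²} g_p(k,s) ds` for `p ≥ 2` in the notation
  of (3)–(6) with `A = 1`; `LiSinai.mode_smul`: the modes of `A v₀` are `A^p · mode v₀ p`, so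
  `LiSinai.seriesSolution (A v₀) t k = Σ' A^p mode v₀ p t k` IS the series (3)/(46)
  (`LiSinai.seriesSolution_smul`);
* supports (`LiSinai.mode_support`, the printed `supp g_p ⊆ C + ⋯ + C`): if `v₀` vanishes off
  `{a ≤ k₃, |k| ≤ R}` then `mode v₀ p (t, ·)` vanishes off `{p a ≤ k₃, |k| ≤ p R}`;
* joint measurability and local boundedness of all modes, integrability of all interaction
  integrands (`LiSinai.measurable_mode`, `LiSinai.mode_bound`, `LiSinai.integrable_pairIntegrand`);
* incompressibility (`LiSinai.inner_seriesSolution`, the printed `g_p ⊥ k`);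
* **`LiSinai.seriesSolution_solvesFourierNSAt`**: for `a > 0` the series is a FINITE sum at each
  `k` (only `p ≤ k₃/a` contribute), and it satisfies `SolvesFourierNSAt` — equation (1) with
  honest integrals — at EVERY `τ ≥ 0` and EVERY `k`, for every bounded measurable datum so
  supported (remark, ours; the paper only needs and states the small-time convergence). So for
  Li–Sinai's data (supported near `(0,0,k⁽⁰⁾)`, `k⁽⁰⁾` large, §1 p. 268 and §7 p. 295) the
  "solution that blows up" exists pointwise in Fourier space for all times and all amplitudes;
  what blows up is its energy `∫ |v(k,t)|² dk` only.
* the named fact `LiSinaiSeriesEnergyBlowup` — the energy profile of this explicit series for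
  one admissible datum: finite on `[0, t)`, infinite at `t` — which is what Theorem 1 (p. 311)
  and §10 (p. 312) assert for `A_cr(t) v(k, 0; b(t))`, and the PROVED implications
  `LiSinaiSeriesEnergyBlowup → LiSinaiCriticalEnergyBlowup → ComplexNavierStokesBlowup`.

## What is NOT here

The energy profile itself (Theorem 1 is a renormalisation-group construction, §3–§9, whose
initial steps `p ≤ 50` and parameter choice are computer-numerical, §7 p. 302, and whose last
inference is informal, §10 p. 312); the small-time finiteness of the energy ([S2], quoted on
p. 270); the enstrophy; the rates of §10. `ComplexNavierStokesBlowup_holds` is therefore NOT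
landed: its remaining content is exactly `LiSinaiSeriesEnergyBlowup`.

## References

* D. Li, Ya. G. Sinai, J. Eur. Math. Soc. 10 (2008) 267–313: §1 p. 268 (eq. (1)), §2
  p. 269–270 (eqs. (3)–(6), `g_p ⊥ k`, `supp g_p`, small-time convergence), §7 p. 295 (data),
  p. 302 (numerics), Thm. 1 p. 311, §10 p. 312 (eq. (46), `A_cr`). [`LiSinai2008`]
-/

noncomputable section

open MeasureTheory Set Filter Topology Finset
open scoped ENNReal InnerProductSpace RealInnerProductSpace BigOperators

namespace Literature.Barriers.NavierStokesRegularity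

/-- Local notation for Fourier space `ℝ³ = EuclideanSpace ℝ (Fin 3)`; `k 2` is the third
coordinate `k₃`. -/
local notation "ℝ³" => EuclideanSpace ℝ (Fin 3)

namespace LiSinai

open Literature.Analysis.FluidPDE (leraySymbol leraySymbol_apply)

/-- The interaction integrand of Li–Sinai's equation (1) between two time-dependent Fourier fields
`F, G` at wave vector `k`, time `s` and integration variable `k'`: `⟨F(s, k - k'), k⟩ · P_k G(s,
k')`, `P_k = leraySymbol k` (`P_k w = w - ⟨w,k⟩k/⟨k,k⟩`, junk `id` at `k = 0`). For `F = G = v`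
this is `fourierNSIntegrand v s k k'`. [cite: LiSinai2008, §1 eq. (1) p. 268] -/
def pairIntegrand (F G : ℝ → ℝ³ → ℝ³) (k : ℝ³) (s : ℝ) (k' : ℝ³) : ℝ³ :=
  ⟪F s (k - k'), k⟫ • leraySymbol k (G s k')

/-- The Duhamel pair of two time-dependent Fourier fields: `duhamelPair F G t k = ∫₀ᵗ e^{-(t-s)|k|²}
(∫ ⟨F(s,k-k'),k⟩ P_k G(s,k') dk') ds` — one summand of the recurrent equations (4)–(6) of
Li–Sinai, written with the outer heat/time integral of (3) included (so that `mode` below is the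
`p`-th TERM of the series (3), not the inner coefficient `g_p`). Interval integral in `s`, Bochner
integral in `k'` (junk `0` if not integrable; all uses below come with integrability). [cite:
LiSinai2008, §2 eqs. (4)–(6) p. 269] -/
def duhamelPair (F G : ℝ → ℝ³ → ℝ³) (t : ℝ) (k : ℝ³) : ℝ³ :=
  ∫ s in (0 : ℝ)..t, Real.exp (-(t - s) * ‖k‖ ^ 2) • ∫ k', pairIntegrand F G k s k'

/-- The modes of Li–Sinai's power series (3) for the datum `v₀` (amplitude `A` absorbed into `v₀`,
cf. `mode_smul`): `mode v₀ 0 = 0` (bookkeeping), `mode v₀ 1 t k = e^{-t|k|²} v₀ k` (= `g_1`, eq.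
(4)), and for `p = m + 2 ≥ 2`, `mode v₀ (m+2) t k = Σ_{i : Fin (m+1)} duhamelPair (mode v₀ (i+1))
(mode v₀ (m-i+1)) t k`, the sum over `p₁ + p₂ = p`, `p₁, p₂ ≥ 1`, of the Duhamel pairs — i.e.
`mode v₀ p t k = ∫₀ᵗ e^{-(t-s)|k|²} g_p(k,s) ds` with `g_p` given by (5)–(6) (the three groups of
terms of (6), `(1, p-1)`, `p₁,p₂ > 1`, `(p-1, 1)`, are all of this form once `g_1(k,s) =
e^{-s|k|²} v(k,0)` is substituted; Fubini in `(s₁, s₂, k')`). Well-founded recursion on `p`.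
[cite: LiSinai2008, §2 eqs. (3)–(6) p. 269] -/
def mode (v₀ : ℝ³ → ℝ³) : ℕ → ℝ → ℝ³ → ℝ³
  | 0 => fun _ _ => 0
  | 1 => fun t k => Real.exp (-t * ‖k‖ ^ 2) • v₀ k
  | m + 2 => fun t k => ∑ i : Fin (m + 1),
      duhamelPair (mode v₀ (i.1 + 1)) (mode v₀ (m - i.1 + 1)) t k

/-- Li–Sinai's power-series solution (3) (= (46) of §10) with amplitude absorbed into the datum:
`seriesSolution v₀ t k = Σ' p, mode v₀ p t k` (unconditional sum in `ℝ³`; for data supported in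
`{k₃ ≥ a > 0}` only finitely many modes are nonzero at each `k`, `seriesSolution_eq_sum`, so no
convergence question arises pointwise). `seriesSolution (A • v₀) t k = Σ' A^p mode v₀ p t k`
(`seriesSolution_smul`). [cite: LiSinai2008, §2 eq. (3) p. 269 and §10 eq. (46) p. 312] -/
def seriesSolution (v₀ : ℝ³ → ℝ³) (t : ℝ) (k : ℝ³) : ℝ³ :=
  ∑' p, mode v₀ p t k

/-- The bookkeeping mode `p = 0` vanishes. [folklore] -/
theorem mode_zero (v₀ : ℝ³ → ℝ³) : mode v₀ 0 = fun _ _ => 0 := by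
  funext t k; simp [mode]

/-- The first mode is the free heat evolution of the datum, `g_1(k,t) = e^{-t|k|²} v(k,0)` (eq.
(4)). [cite: LiSinai2008, §2 eq. (4) p. 269] -/
theorem mode_one (v₀ : ℝ³ → ℝ³) (t : ℝ) (k : ℝ³) :
    mode v₀ 1 t k = Real.exp (-t * ‖k‖ ^ 2) • v₀ k := by
  simp [mode]

/-- Unfolding the recursion for `p = m + 2 ≥ 2` (eqs. (5)–(6) in Duhamel form). [cite:
LiSinai2008, §2 eqs. (5)–(6) p. 269] -/
theorem mode_add_two (v₀ : ℝ³ → ℝ³) (m : ℕ) (t : ℝ) (k : ℝ³) :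
    mode v₀ (m + 2) t k =
      ∑ i : Fin (m + 1), duhamelPair (mode v₀ (i.1 + 1)) (mode v₀ (m - i.1 + 1)) t k := by
  rw [mode]

/-- The recursion for `p = m + 2` as a sum over the antidiagonal `{(i, j) : i + j = m}`: `mode v₀
(m+2) = Σ_{i+j=m} duhamelPair (mode v₀ (i+1)) (mode v₀ (j+1))`. [cite: LiSinai2008, §2 eq. (6) p.
269] -/
theorem mode_add_two_eq_sum_antidiagonal (v₀ : ℝ³ → ℝ³) (m : ℕ) (t : ℝ) (k : ℝ³) :
    mode v₀ (m + 2) t k =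
      ∑ pq ∈ antidiagonal m, duhamelPair (mode v₀ (pq.1 + 1)) (mode v₀ (pq.2 + 1)) t k := by
  rw [mode_add_two, Nat.sum_antidiagonal_eq_sum_range_succ_mk,
    ← Fin.sum_univ_eq_sum_range (fun i => duhamelPair (mode v₀ (i + 1)) (mode v₀ (m - i + 1)) t k)]

/-! ### Vanishing and supports -/

/-- The interaction integrand vanishes when the first field does. [folklore] -/
theorem pairIntegrand_zero_left (G : ℝ → ℝ³ → ℝ³) (k : ℝ³) :
    pairIntegrand (fun _ _ => 0) G k = fun _ _ => 0 := by
  funext s k'; simp [pairIntegrand]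

/-- The interaction integrand vanishes when the second field does. [folklore] -/
theorem pairIntegrand_zero_right (F : ℝ → ℝ³ → ℝ³) (k : ℝ³) :
    pairIntegrand F (fun _ _ => 0) k = fun _ _ => 0 := by
  funext s k'; simp [pairIntegrand]

/-- A Duhamel pair with identically vanishing integrand vanishes. [folklore] -/
theorem duhamelPair_eq_zero_of_integrand {F G : ℝ → ℝ³ → ℝ³} {k : ℝ³}
    (h : pairIntegrand F G k = fun _ _ => 0) (t : ℝ) : duhamelPair F G t k = 0 := by
  simp [duhamelPair, h]

/-- `duhamelPair 0 G = 0`. [folklore] -/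
theorem duhamelPair_zero_left (G : ℝ → ℝ³ → ℝ³) (t : ℝ) (k : ℝ³) :
    duhamelPair (fun _ _ => 0) G t k = 0 :=
  duhamelPair_eq_zero_of_integrand (pairIntegrand_zero_left G k) t

/-- `duhamelPair F 0 = 0`. [folklore] -/
theorem duhamelPair_zero_right (F : ℝ → ℝ³ → ℝ³) (t : ℝ) (k : ℝ³) :
    duhamelPair F (fun _ _ => 0) t k = 0 :=
  duhamelPair_eq_zero_of_integrand (pairIntegrand_zero_right F k) t

/-- If `F(s, ·)` vanishes off `{P ≤ k₃, |k| ≤ Q}` and `G(s, ·)` off `{P' ≤ k₃, |k| ≤ Q'}`, the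
interaction integrand at `k` vanishes identically in `(s, k')` unless `P + P' ≤ k₃` and `|k| ≤ Q +
Q'` (`k₃ = (k-k')₃ + k'₃`, `|k| ≤ |k-k'| + |k'|`). [cite: LiSinai2008, §2 p. 270] -/
theorem pairIntegrand_eq_zero_of_not {F G : ℝ → ℝ³ → ℝ³} {P Q P' Q' : ℝ}
    (hF : ∀ s k, F s k ≠ 0 → P ≤ k 2 ∧ ‖k‖ ≤ Q) (hG : ∀ s k, G s k ≠ 0 → P' ≤ k 2 ∧ ‖k‖ ≤ Q')
    {k : ℝ³} (hk : ¬(P + P' ≤ k 2 ∧ ‖k‖ ≤ Q + Q')) :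
    pairIntegrand F G k = fun _ _ => 0 := by
  funext s k'
  by_cases hGz : G s k' = 0
  · simp [pairIntegrand, hGz]
  by_cases hFz : F s (k - k') = 0
  · simp [pairIntegrand, hFz]
  exfalso
  obtain ⟨h1, h2⟩ := hF s (k - k') hFz
  obtain ⟨h3, h4⟩ := hG s k' hGz
  refine hk ⟨?_, ?_⟩
  · have : (k - k') 2 = k 2 - k' 2 := by simp
    linarith
  · calc ‖k‖ = ‖(k - k') + k'‖ := by rw [sub_add_cancel]
      _ ≤ ‖k - k'‖ + ‖k'‖ := norm_add_le _ _
      _ ≤ Q + Q' := add_le_add h2 h4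

/-- Supports add under the Duhamel pairing: if `F(s,·)` vanishes off `{P ≤ k₃, |k| ≤ Q}` and
`G(s,·)` off `{P' ≤ k₃, |k| ≤ Q'}` then `duhamelPair F G (t,·)` vanishes off `{P + P' ≤ k₃, |k| ≤
Q + Q'}` (the inductive step of `supp g_p ⊆ C + ⋯ + C`). [cite: LiSinai2008, §2 p. 270] -/
theorem duhamelPair_support {F G : ℝ → ℝ³ → ℝ³} {P Q P' Q' : ℝ}
    (hF : ∀ s k, F s k ≠ 0 → P ≤ k 2 ∧ ‖k‖ ≤ Q) (hG : ∀ s k, G s k ≠ 0 → P' ≤ k 2 ∧ ‖k‖ ≤ Q')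
    (t : ℝ) (k : ℝ³) (h : duhamelPair F G t k ≠ 0) : P + P' ≤ k 2 ∧ ‖k‖ ≤ Q + Q' := by
  by_contra hk
  exact h (duhamelPair_eq_zero_of_integrand (pairIntegrand_eq_zero_of_not hF hG hk) t)

/-- **Supports of the modes** (`supp g_p = C + ⋯ + C`, `p` times): if the datum vanishes off `{a ≤
k₃, |k| ≤ R}` then `mode v₀ m (t, ·)` vanishes off `{m a ≤ k₃, |k| ≤ m R}`, for every `m` and
every real `t`. [cite: LiSinai2008, §2 p. 270] -/
theorem mode_support {v₀ : ℝ³ → ℝ³} {a R : ℝ} (hv₀ : ∀ k, v₀ k ≠ 0 → a ≤ k 2 ∧ ‖k‖ ≤ R) :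
    ∀ m t k, mode v₀ m t k ≠ 0 → (m : ℝ) * a ≤ k 2 ∧ ‖k‖ ≤ m * R := by
  intro m
  induction m using Nat.strong_induction_on with
  | _ m ih =>
  intro t k hk
  rcases m with _ | _ | m
  · simp [mode_zero] at hk
  · have hk1 : mode v₀ 1 t k ≠ 0 := hk
    rw [mode_one] at hk1
    have hv : v₀ k ≠ 0 := fun h => hk1 (by simp [h])
    simpa using hv₀ k hv
  · have hk2 : mode v₀ (m + 2) t k ≠ 0 := hk
    rw [mode_add_two] at hk2
    obtain ⟨i, -, hi⟩ := Finset.exists_ne_zero_of_sum_ne_zero hk2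
    have hi2 := i.2
    have h1 := ih (i.1 + 1) (by omega)
    have h2 := ih (m - i.1 + 1) (by omega)
    have h12 := duhamelPair_support h1 h2 t k hi
    have hsum : ((i.1 + 1 : ℕ) : ℝ) + ((m - i.1 + 1 : ℕ) : ℝ) = ((m + 1 + 1 : ℕ) : ℝ) := by
      rw [← Nat.cast_add]; congr 1; omega
    refine ⟨?_, ?_⟩
    · rw [← hsum, add_mul]; exact h12.1
    · rw [← hsum, add_mul]; exact h12.2

/-- The mode of order `m` vanishes at wave vectors with `k₃ < m a`. [cite: LiSinai2008, §2 p. 270]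
-/
theorem mode_eq_zero_of_lt {v₀ : ℝ³ → ℝ³} {a R : ℝ} (hv₀ : ∀ k, v₀ k ≠ 0 → a ≤ k 2 ∧ ‖k‖ ≤ R)
    {m : ℕ} {k : ℝ³} (hk : k 2 < m * a) (t : ℝ) : mode v₀ m t k = 0 := by
  by_contra h
  exact (not_le.2 hk) (mode_support hv₀ m t k h).1

/-- Modes of order `m ≥ N` vanish at `k` when `k₃ < N a` (`a > 0`). [cite: LiSinai2008, §2 p. 270]
-/
theorem mode_eq_zero_of_le {v₀ : ℝ³ → ℝ³} {a R : ℝ} (ha : 0 < a)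
    (hv₀ : ∀ k, v₀ k ≠ 0 → a ≤ k 2 ∧ ‖k‖ ≤ R) {N m : ℕ} {k : ℝ³} (hk : k 2 < N * a) (hm : N ≤ m)
    (t : ℝ) : mode v₀ m t k = 0 :=
  mode_eq_zero_of_lt hv₀ (hk.trans_le (by gcongr)) t

/-- **The series is a finite sum at each wave vector**: for `a > 0` and `k₃ < N a`,
`seriesSolution v₀ t k = Σ_{p < N} mode v₀ p t k`. [cite: LiSinai2008, §2 p. 270] -/
theorem seriesSolution_eq_sum {v₀ : ℝ³ → ℝ³} {a R : ℝ} (ha : 0 < a)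
    (hv₀ : ∀ k, v₀ k ≠ 0 → a ≤ k 2 ∧ ‖k‖ ≤ R) {N : ℕ} {k : ℝ³} (hk : k 2 < N * a) (t : ℝ) :
    seriesSolution v₀ t k = ∑ p ∈ Finset.range N, mode v₀ p t k := by
  unfold seriesSolution
  refine tsum_eq_sum fun p hp => ?_
  exact mode_eq_zero_of_le ha hv₀ hk (by simpa using hp) t

/-- Every mode vanishes at wave vectors with `k₃ < a` (`a > 0`). [cite: LiSinai2008, §2 p. 270] -/
theorem mode_eq_zero_of_lt_a {v₀ : ℝ³ → ℝ³} {a R : ℝ} (ha : 0 < a)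
    (hv₀ : ∀ k, v₀ k ≠ 0 → a ≤ k 2 ∧ ‖k‖ ≤ R) {k : ℝ³} (hk : k 2 < a) (p : ℕ) (t : ℝ) :
    mode v₀ p t k = 0 := by
  rcases p with _ | p
  · simp [mode_zero]
  · refine mode_eq_zero_of_lt hv₀ (hk.trans_le ?_) t
    have : (1 : ℝ) ≤ (p + 1 : ℕ) := by exact_mod_cast Nat.succ_pos p
    nlinarith

/-- The series vanishes at wave vectors with `k₃ < a` (`a > 0`). [cite: LiSinai2008, §2 p. 270] -/
theorem seriesSolution_eq_zero {v₀ : ℝ³ → ℝ³} {a R : ℝ} (ha : 0 < a)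
    (hv₀ : ∀ k, v₀ k ≠ 0 → a ≤ k 2 ∧ ‖k‖ ≤ R) {k : ℝ³} (hk : k 2 < a) (t : ℝ) :
    seriesSolution v₀ t k = 0 := by
  unfold seriesSolution
  simp [mode_eq_zero_of_lt_a ha hv₀ hk]

/-- At time `0` every mode but the first vanishes (the time integral over `[0, 0]`). [folklore] -/
theorem mode_at_zero (v₀ : ℝ³ → ℝ³) (p : ℕ) (k : ℝ³) (hp : p ≠ 1) : mode v₀ p 0 k = 0 := by
  rcases p with _ | _ | m
  · simp [mode_zero]
  · exact absurd rfl hp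
  · have : mode v₀ (m + 2) 0 k = 0 := by
      rw [mode_add_two]
      exact Finset.sum_eq_zero fun i _ => by simp [duhamelPair]
    exact this

/-- The series has the right initial value: `seriesSolution v₀ 0 = v₀`. [folklore] -/
theorem seriesSolution_zero (v₀ : ℝ³ → ℝ³) : seriesSolution v₀ 0 = v₀ := by
  funext k
  unfold seriesSolution
  rw [tsum_eq_single 1 (fun p hp => mode_at_zero v₀ p k hp), mode_one]
  simp

/-! ### A regrouping identity -/

/-- Regrouping a double sum over `[0, M)²` whose terms vanish for `p + q ≥ M` as a sum over
antidiagonals `p + q = m`, `m < M`. [folklore] -/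
theorem sum_range_range_eq_sum_antidiagonal {β : Type*} [AddCommMonoid β] (f : ℕ × ℕ → β)
    (M : ℕ) (hf : ∀ p q, M ≤ p + q → f (p, q) = 0) :
    ∑ p ∈ range M, ∑ q ∈ range M, f (p, q) = ∑ m ∈ range M, ∑ pq ∈ antidiagonal m, f pq := by
  classical
  set T : Finset (ℕ × ℕ) := (range M ×ˢ range M).filter (fun x => x.1 + x.2 < M) with hT
  have hL : ∑ p ∈ range M, ∑ q ∈ range M, f (p, q) = ∑ x ∈ T, f x := by
    rw [← Finset.sum_product (range M) (range M) f, hT, Finset.sum_filter_of_ne]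
    intro x _ hne
    by_contra h
    exact hne (hf x.1 x.2 (not_lt.1 h))
  have hR : ∑ m ∈ range M, ∑ pq ∈ antidiagonal m, f pq =
      ∑ m ∈ range M, ∑ x ∈ T with x.1 + x.2 = m, f x := by
    refine Finset.sum_congr rfl fun m hm => ?_
    congr 1
    ext x
    simp only [mem_antidiagonal, hT, Finset.mem_filter, Finset.mem_product, Finset.mem_range]
    simp only [Finset.mem_range] at hm
    omega
  rw [hL, hR, Finset.sum_fiberwise_of_maps_to]
  intro x hx
  simp only [hT, Finset.mem_filter] at hx
  simpa using hx.2


/-! ### Measurability -/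

/-- The Leray symbol `(ξ, a) ↦ P_ξ a = a - |ξ|⁻²⟨ξ,a⟩ξ` is jointly Borel measurable (Lean's `0⁻¹ =
0` at `ξ = 0`). [folklore] -/
theorem measurable_leraySymbol_apply :
    Measurable fun p : ℝ³ × ℝ³ => leraySymbol p.1 p.2 := by
  have : (fun p : ℝ³ × ℝ³ => leraySymbol p.1 p.2) =
      fun p => p.2 - (‖p.1‖ ^ 2)⁻¹ • (⟪p.1, p.2⟫ • p.1) := by
    funext p; rw [leraySymbol_apply]
  rw [this]
  fun_prop

/-- Joint measurability of the interaction integrand in `((s, k), k')` for jointly measurable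
fields. [folklore] -/
theorem measurable_pairIntegrand {F G : ℝ → ℝ³ → ℝ³} (hF : Measurable (Function.uncurry F))
    (hG : Measurable (Function.uncurry G)) :
    Measurable fun x : (ℝ × ℝ³) × ℝ³ => pairIntegrand F G x.1.2 x.1.1 x.2 := by
  have h1 : Measurable fun x : (ℝ × ℝ³) × ℝ³ => F x.1.1 (x.1.2 - x.2) :=
    Measurable.comp hF
      (show Measurable fun x : (ℝ × ℝ³) × ℝ³ => (x.1.1, x.1.2 - x.2) by fun_prop)
  have h2 : Measurable fun x : (ℝ × ℝ³) × ℝ³ => G x.1.1 x.2 :=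
    Measurable.comp hG (show Measurable fun x : (ℝ × ℝ³) × ℝ³ => (x.1.1, x.2) by fun_prop)
  have h3 : Measurable fun x : (ℝ × ℝ³) × ℝ³ => leraySymbol x.1.2 (G x.1.1 x.2) := by
    have : (fun x : (ℝ × ℝ³) × ℝ³ => leraySymbol x.1.2 (G x.1.1 x.2)) =
        (fun p : ℝ³ × ℝ³ => leraySymbol p.1 p.2) ∘ fun x => (x.1.2, G x.1.1 x.2) := rfl
    rw [this]
    exact measurable_leraySymbol_apply.comp (measurable_fst.snd.prodMk h2)
  have h4 : Measurable fun x : (ℝ × ℝ³) × ℝ³ => ⟪F x.1.1 (x.1.2 - x.2), x.1.2⟫ :=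
    h1.inner measurable_fst.snd
  show Measurable fun x : (ℝ × ℝ³) × ℝ³ =>
    ⟪F x.1.1 (x.1.2 - x.2), x.1.2⟫ • leraySymbol x.1.2 (G x.1.1 x.2)
  exact h4.smul h3

/-- The `k'`-integral of the interaction integrand is (strongly) measurable in `(s, k)`
(measurability of parametric Bochner integrals, Mathlib
`StronglyMeasurable.integral_prod_right'`). [folklore] -/
theorem stronglyMeasurable_integral_pairIntegrand {F G : ℝ → ℝ³ → ℝ³}
    (hF : Measurable (Function.uncurry F)) (hG : Measurable (Function.uncurry G)) :
    StronglyMeasurable fun y : ℝ × ℝ³ => ∫ k', pairIntegrand F G y.2 y.1 k' :=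
  (measurable_pairIntegrand hF hG).stronglyMeasurable.integral_prod_right'

/-- Joint measurability in `((t, k), s)` of the time integrand `e^{-(t-s)|k|²} ∫ ⟨F(s,k-k'),k⟩ P_k
G(s,k') dk'` of the Duhamel pair. [folklore] -/
theorem measurable_duhamelIntegrand {F G : ℝ → ℝ³ → ℝ³}
    (hF : Measurable (Function.uncurry F)) (hG : Measurable (Function.uncurry G)) :
    Measurable fun z : (ℝ × ℝ³) × ℝ =>
      Real.exp (-(z.1.1 - z.2) * ‖z.1.2‖ ^ 2) • ∫ k', pairIntegrand F G z.1.2 z.2 k' := by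
  have hA : Measurable fun z : (ℝ × ℝ³) × ℝ => Real.exp (-(z.1.1 - z.2) * ‖z.1.2‖ ^ 2) := by
    fun_prop
  have hB : Measurable fun z : (ℝ × ℝ³) × ℝ => ∫ k', pairIntegrand F G z.1.2 z.2 k' := by
    have : (fun z : (ℝ × ℝ³) × ℝ => ∫ k', pairIntegrand F G z.1.2 z.2 k') =
        (fun y : ℝ × ℝ³ => ∫ k', pairIntegrand F G y.2 y.1 k') ∘ fun z => (z.2, z.1.2) := rfl
    rw [this]
    exact (stronglyMeasurable_integral_pairIntegrand hF hG).measurable.comp (by fun_prop)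
  exact hA.smul hB

/-- Joint measurability in `(t, k)` of the Duhamel pair of jointly measurable fields (the interval
integral is a difference of two integrals of indicators of measurable subsets of `(ℝ × ℝ³) × ℝ`).
[folklore] -/
theorem measurable_duhamelPair {F G : ℝ → ℝ³ → ℝ³} (hF : Measurable (Function.uncurry F))
    (hG : Measurable (Function.uncurry G)) :
    Measurable (Function.uncurry (duhamelPair F G)) := by
  set Ψ : (ℝ × ℝ³) × ℝ → ℝ³ := fun z =>
    Real.exp (-(z.1.1 - z.2) * ‖z.1.2‖ ^ 2) • ∫ k', pairIntegrand F G z.1.2 z.2 k' with hΨ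
  have hΨm : Measurable Ψ := measurable_duhamelIntegrand hF hG
  set S₁ : Set ((ℝ × ℝ³) × ℝ) := {z | 0 < z.2 ∧ z.2 ≤ z.1.1} with hS₁
  set S₂ : Set ((ℝ × ℝ³) × ℝ) := {z | z.1.1 < z.2 ∧ z.2 ≤ 0} with hS₂
  have hS₁m : MeasurableSet S₁ :=
    (measurableSet_lt measurable_const measurable_snd).inter
      (measurableSet_le measurable_snd measurable_fst.fst)
  have hS₂m : MeasurableSet S₂ :=
    (measurableSet_lt measurable_fst.fst measurable_snd).inter
      (measurableSet_le measurable_snd measurable_const)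
  have h1 : Measurable fun y : ℝ × ℝ³ => ∫ s, S₁.indicator Ψ (y, s) :=
    ((hΨm.indicator hS₁m).stronglyMeasurable.integral_prod_right').measurable
  have h2 : Measurable fun y : ℝ × ℝ³ => ∫ s, S₂.indicator Ψ (y, s) :=
    ((hΨm.indicator hS₂m).stronglyMeasurable.integral_prod_right').measurable
  have heq : Function.uncurry (duhamelPair F G) =
      fun y : ℝ × ℝ³ => (∫ s, S₁.indicator Ψ (y, s)) - ∫ s, S₂.indicator Ψ (y, s) := by
    funext y
    simp only [Function.uncurry, duhamelPair, intervalIntegral]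
    congr 1
    · rw [← integral_indicator measurableSet_Ioc]
      congr 1 with s
    · rw [← integral_indicator measurableSet_Ioc]
      congr 1 with s
  rw [heq]
  exact h1.sub h2

/-- Every mode `mode v₀ m` of a measurable datum is jointly Borel measurable in `(t, k)` (strong
induction on `m`). [folklore] -/
theorem measurable_mode {v₀ : ℝ³ → ℝ³} (hv₀ : Measurable v₀) :
    ∀ m, Measurable (Function.uncurry (mode v₀ m)) := by
  intro m
  induction m using Nat.strong_induction_on with
  | _ m ih =>
  rcases m with _ | _ | m
  · rw [mode_zero]; exact measurable_const
  · show Measurable (Function.uncurry (mode v₀ 1))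
    have : Function.uncurry (mode v₀ 1) =
        fun y : ℝ × ℝ³ => Real.exp (-y.1 * ‖y.2‖ ^ 2) • v₀ y.2 := by
      funext ⟨t, k⟩; simp only [Function.uncurry_apply_pair, mode_one]
    rw [this]
    have hA : Measurable fun y : ℝ × ℝ³ => Real.exp (-y.1 * ‖y.2‖ ^ 2) := by fun_prop
    exact hA.smul (hv₀.comp measurable_snd)
  · show Measurable (Function.uncurry (mode v₀ (m + 2)))
    have : Function.uncurry (mode v₀ (m + 2)) = fun y : ℝ × ℝ³ => ∑ i : Fin (m + 1),
        Function.uncurry (duhamelPair (mode v₀ (i.1 + 1)) (mode v₀ (m - i.1 + 1))) y := by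
      funext ⟨t, k⟩; simp only [Function.uncurry_apply_pair, mode_add_two]
    rw [this]
    refine Finset.measurable_fun_sum _ fun i _ => ?_
    have hi2 := i.2
    exact measurable_duhamelPair (ih _ (by omega)) (ih _ (by omega))

/-- Measurability of each time slice `mode v₀ m t` of a mode. [folklore] -/
theorem measurable_mode_slice {v₀ : ℝ³ → ℝ³} (hv₀ : Measurable v₀) (m : ℕ) (t : ℝ) :
    Measurable (mode v₀ m t) :=
  (measurable_mode hv₀ m).comp (measurable_const.prodMk measurable_id)

/-! ### Bounds -/

/-- Crude bound for the Leray symbol, `‖P_ξ v‖ ≤ 2‖v‖` (Cauchy–Schwarz; the sharp bound is `‖v‖`,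
cf. `Literature.Analysis.FluidPDE.norm_leraySymbol_apply_le`, not imported here). [folklore] -/
theorem norm_leraySymbol_apply_le_two_mul (ξ v : ℝ³) : ‖leraySymbol ξ v‖ ≤ 2 * ‖v‖ := by
  rw [leraySymbol_apply]
  by_cases hξ : ξ = 0
  · simp [hξ]; linarith [norm_nonneg v]
  have hn : 0 < ‖ξ‖ := norm_pos_iff.2 hξ
  calc ‖v - (‖ξ‖ ^ 2)⁻¹ • (⟪ξ, v⟫ • ξ)‖ ≤ ‖v‖ + ‖(‖ξ‖ ^ 2)⁻¹ • (⟪ξ, v⟫ • ξ)‖ := norm_sub_le _ _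
    _ = ‖v‖ + (‖ξ‖ ^ 2)⁻¹ * (|⟪ξ, v⟫| * ‖ξ‖) := by
        rw [norm_smul, norm_smul, norm_inv, norm_pow, norm_norm, Real.norm_eq_abs]
    _ ≤ ‖v‖ + (‖ξ‖ ^ 2)⁻¹ * (‖ξ‖ * ‖v‖ * ‖ξ‖) := by
        gcongr; exact abs_real_inner_le_norm ξ v
    _ = ‖v‖ + ‖v‖ := by field_simp
    _ = 2 * ‖v‖ := by ring

/-- Pointwise bound `‖⟨F(s,k-k'),k⟩ P_k G(s,k')‖ ≤ |k| · M_F · 2 M_G` from sup bounds on the two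
fields. [folklore] -/
theorem norm_pairIntegrand_le {F G : ℝ → ℝ³ → ℝ³} {k : ℝ³} {s : ℝ} {MF MG : ℝ}
    (hF : ∀ k'', ‖F s k''‖ ≤ MF) (hG : ∀ k', ‖G s k'‖ ≤ MG) (k' : ℝ³) :
    ‖pairIntegrand F G k s k'‖ ≤ ‖k‖ * MF * (2 * MG) := by
  have hMF : 0 ≤ MF := (norm_nonneg _).trans (hF 0)
  unfold pairIntegrand
  rw [norm_smul, Real.norm_eq_abs]
  have h1 : |⟪F s (k - k'), k⟫| ≤ ‖k‖ * MF := by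
    calc |⟪F s (k - k'), k⟫| ≤ ‖F s (k - k')‖ * ‖k‖ := abs_real_inner_le_norm _ _
      _ ≤ MF * ‖k‖ := by gcongr; exact hF _
      _ = ‖k‖ * MF := mul_comm _ _
  have h2 : ‖leraySymbol k (G s k')‖ ≤ 2 * MG :=
    (norm_leraySymbol_apply_le_two_mul _ _).trans (by gcongr; exact hG _)
  exact mul_le_mul h1 h2 (norm_nonneg _) (by positivity)

/-- The interaction integrand is dominated by a constant multiple of the indicator of a ball
containing the support of `G(s, ·)`. [folklore] -/
theorem norm_pairIntegrand_le_indicator {F G : ℝ → ℝ³ → ℝ³} {k : ℝ³} {s : ℝ} {MF MG ρ : ℝ}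
    (hF : ∀ k'', ‖F s k''‖ ≤ MF) (hG : ∀ k', ‖G s k'‖ ≤ MG)
    (hGs : ∀ k', G s k' ≠ 0 → ‖k'‖ ≤ ρ) (k' : ℝ³) :
    ‖pairIntegrand F G k s k'‖ ≤
      (Metric.closedBall (0 : ℝ³) ρ).indicator (fun _ => ‖k‖ * MF * (2 * MG)) k' := by
  have hMF : 0 ≤ MF := (norm_nonneg _).trans (hF 0)
  have hMG : 0 ≤ MG := (norm_nonneg _).trans (hG 0)
  by_cases hz : G s k' = 0
  · have : pairIntegrand F G k s k' = 0 := by simp [pairIntegrand, hz]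
    rw [this, norm_zero]
    exact Set.indicator_nonneg (fun _ _ => by positivity) _
  · have hmem : k' ∈ Metric.closedBall (0 : ℝ³) ρ := by simpa using hGs k' hz
    rw [Set.indicator_of_mem hmem]
    exact norm_pairIntegrand_le hF hG k'

/-- The Lebesgue volume of the closed ball `B(0, ρ)` of Fourier space, as a real number (finite; `0`
for `ρ < 0`). [folklore] -/
def ballVol (ρ : ℝ) : ℝ := (volume : Measure ℝ³).real (Metric.closedBall (0 : ℝ³) ρ)

/-- `ballVol ρ ≥ 0`. [folklore] -/
theorem ballVol_nonneg (ρ : ℝ) : 0 ≤ ballVol ρ := measureReal_nonneg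

/-- Constant multiples of indicators of closed balls are integrable on Fourier space. [folklore] -/
theorem integrable_ballIndicator (ρ C : ℝ) :
    Integrable ((Metric.closedBall (0 : ℝ³) ρ).indicator fun _ => C) (volume : Measure ℝ³) :=
  (integrableOn_const (measure_closedBall_lt_top).ne).integrable_indicator
    measurableSet_closedBall

/-- Integrability in `k'` of the interaction integrand of bounded jointly measurable fields, the
second of which has `k'`-support in a ball (dominated by `integrable_ballIndicator`). This is the
integrability making the `k'`-integral in (1) honest. [folklore] -/
theorem integrable_pairIntegrand {F G : ℝ → ℝ³ → ℝ³} {k : ℝ³} {s : ℝ} {MF MG ρ : ℝ}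
    (hFm : Measurable (Function.uncurry F)) (hGm : Measurable (Function.uncurry G))
    (hF : ∀ k'', ‖F s k''‖ ≤ MF) (hG : ∀ k', ‖G s k'‖ ≤ MG)
    (hGs : ∀ k', G s k' ≠ 0 → ‖k'‖ ≤ ρ) :
    Integrable (pairIntegrand F G k s) (volume : Measure ℝ³) := by
  refine (integrable_ballIndicator ρ (‖k‖ * MF * (2 * MG))).mono' ?_
    (Eventually.of_forall (norm_pairIntegrand_le_indicator hF hG hGs))
  exact (Measurable.comp (measurable_pairIntegrand hFm hGm)
    (show Measurable fun k' : ℝ³ => ((s, k), k') by fun_prop)).aestronglyMeasurable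

/-- `‖∫ ⟨F(s,k-k'),k⟩ P_k G(s,k') dk'‖ ≤ |k| M_F 2M_G · vol B(0, ρ)`. [folklore] -/
theorem norm_integral_pairIntegrand_le {F G : ℝ → ℝ³ → ℝ³} {k : ℝ³} {s : ℝ} {MF MG ρ : ℝ}
    (hF : ∀ k'', ‖F s k''‖ ≤ MF) (hG : ∀ k', ‖G s k'‖ ≤ MG)
    (hGs : ∀ k', G s k' ≠ 0 → ‖k'‖ ≤ ρ) :
    ‖∫ k', pairIntegrand F G k s k'‖ ≤ ‖k‖ * MF * (2 * MG) * ballVol ρ := by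
  refine (norm_integral_le_of_norm_le (integrable_ballIndicator ρ _)
    (Eventually.of_forall (norm_pairIntegrand_le_indicator hF hG hGs))).trans ?_
  rw [integral_indicator_const _ measurableSet_closedBall, smul_eq_mul, ballVol, mul_comm]

/-- Sup bound for a Duhamel pair on `[0, T]`: if `‖F‖ ≤ M_F`, `‖G‖ ≤ M_G` on `[0,T] × ℝ³` and
`G(s,·)` is supported in `B(0,ρ)`, then `‖duhamelPair F G t k‖ ≤ T · |k| M_F 2M_G vol B(0,ρ)` for
`t ∈ [0, T]` (the heat factor is `≤ 1`). [folklore] -/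
theorem norm_duhamelPair_le {F G : ℝ → ℝ³ → ℝ³} {T MF MG ρ : ℝ}
    (hF : ∀ s ∈ Icc 0 T, ∀ k, ‖F s k‖ ≤ MF) (hG : ∀ s ∈ Icc 0 T, ∀ k, ‖G s k‖ ≤ MG)
    (hGs : ∀ s ∈ Icc 0 T, ∀ k, G s k ≠ 0 → ‖k‖ ≤ ρ) {t : ℝ} (ht : t ∈ Icc 0 T) (k : ℝ³) :
    ‖duhamelPair F G t k‖ ≤ T * (‖k‖ * MF * (2 * MG) * ballVol ρ) := by
  have hC : 0 ≤ ‖k‖ * MF * (2 * MG) * ballVol ρ := by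
    rcases le_or_gt 0 T with hT | hT
    · have hMF : 0 ≤ MF := (norm_nonneg _).trans (hF 0 ⟨le_rfl, hT⟩ 0)
      have hMG : 0 ≤ MG := (norm_nonneg _).trans (hG 0 ⟨le_rfl, hT⟩ 0)
      have := ballVol_nonneg ρ
      positivity
    · exact absurd (ht.1.trans ht.2) (not_le.2 hT)
  unfold duhamelPair
  have hbound : ∀ s ∈ Set.uIoc (0 : ℝ) t,
      ‖Real.exp (-(t - s) * ‖k‖ ^ 2) • ∫ k', pairIntegrand F G k s k'‖ ≤
        ‖k‖ * MF * (2 * MG) * ballVol ρ := by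
    intro s hs
    rw [uIoc_of_le ht.1] at hs
    have hsT : s ∈ Icc 0 T := ⟨hs.1.le, hs.2.trans ht.2⟩
    rw [norm_smul, Real.norm_eq_abs, abs_of_pos (Real.exp_pos _)]
    have hexp : Real.exp (-(t - s) * ‖k‖ ^ 2) ≤ 1 := by
      rw [Real.exp_le_one_iff]
      nlinarith [hs.2, sq_nonneg ‖k‖]
    calc Real.exp (-(t - s) * ‖k‖ ^ 2) * ‖∫ k', pairIntegrand F G k s k'‖
        ≤ 1 * (‖k‖ * MF * (2 * MG) * ballVol ρ) :=
          mul_le_mul hexp (norm_integral_pairIntegrand_le (hF s hsT) (hG s hsT) (hGs s hsT))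
            (norm_nonneg _) zero_le_one
      _ = _ := one_mul _
  calc ‖∫ s in (0 : ℝ)..t, Real.exp (-(t - s) * ‖k‖ ^ 2) • ∫ k', pairIntegrand F G k s k'‖
      ≤ (‖k‖ * MF * (2 * MG) * ballVol ρ) * |t - 0| :=
        intervalIntegral.norm_integral_le_of_norm_le_const hbound
    _ ≤ (‖k‖ * MF * (2 * MG) * ballVol ρ) * T := by
        rw [sub_zero, abs_of_nonneg ht.1]; exact mul_le_mul_of_nonneg_left ht.2 hC
    _ = _ := mul_comm _ _

/-- Interval integrability on `[0, τ] ⊆ [0, T]` of the Duhamel time integrand of bounded jointly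
measurable fields with `G` supported in a ball: bounded and measurable on a bounded interval. This
is the integrability making the `s`-integral in (1) honest. [folklore] -/
theorem intervalIntegrable_duhamelIntegrand {F G : ℝ → ℝ³ → ℝ³} {T MF MG ρ : ℝ}
    (hFm : Measurable (Function.uncurry F)) (hGm : Measurable (Function.uncurry G))
    (hF : ∀ s ∈ Icc 0 T, ∀ k, ‖F s k‖ ≤ MF) (hG : ∀ s ∈ Icc 0 T, ∀ k, ‖G s k‖ ≤ MG)
    (hGs : ∀ s ∈ Icc 0 T, ∀ k, G s k ≠ 0 → ‖k‖ ≤ ρ) {τ : ℝ} (hτ : τ ∈ Icc 0 T) (k : ℝ³) :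
    IntervalIntegrable
      (fun s => Real.exp (-(τ - s) * ‖k‖ ^ 2) • ∫ k', pairIntegrand F G k s k') volume 0 τ := by
  refine (intervalIntegrable_const (c := ‖k‖ * MF * (2 * MG) * ballVol ρ)).mono_fun' ?_ ?_
  · exact (Measurable.comp (measurable_duhamelIntegrand hFm hGm)
      (show Measurable fun s : ℝ => ((τ, k), s) by fun_prop)).aestronglyMeasurable
  · refine (ae_restrict_of_forall_mem measurableSet_uIoc) fun s hs => ?_
    rw [uIoc_of_le hτ.1] at hs
    have hsT : s ∈ Icc 0 T := ⟨hs.1.le, hs.2.trans hτ.2⟩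
    dsimp only
    rw [norm_smul, Real.norm_eq_abs, abs_of_pos (Real.exp_pos _)]
    have hexp : Real.exp (-(τ - s) * ‖k‖ ^ 2) ≤ 1 := by
      rw [Real.exp_le_one_iff]
      nlinarith [hs.2, sq_nonneg ‖k‖]
    calc Real.exp (-(τ - s) * ‖k‖ ^ 2) * ‖∫ k', pairIntegrand F G k s k'‖
        ≤ 1 * (‖k‖ * MF * (2 * MG) * ballVol ρ) :=
          mul_le_mul hexp (norm_integral_pairIntegrand_le (hF s hsT) (hG s hsT) (hGs s hsT))
            (norm_nonneg _) zero_le_one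
      _ = _ := one_mul _

/-- **Local boundedness of the modes**: for a bounded datum vanishing off `{a ≤ k₃, |k| ≤ R}` and
every `T`, the modes of order `≤ n` are uniformly bounded on `[0, T] × ℝ³` (induction on `n`,
using `mode_support` for the `|k|`-factor and the `k'`-supports; the bound is crude — no claim of
uniformity in `n`). [folklore] -/
theorem mode_bound {v₀ : ℝ³ → ℝ³} {a R M₀ : ℝ} (hv₀ : ∀ k, v₀ k ≠ 0 → a ≤ k 2 ∧ ‖k‖ ≤ R)
    (hM₀ : ∀ k, ‖v₀ k‖ ≤ M₀) (T : ℝ) :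
    ∀ n, ∃ M, 0 ≤ M ∧ ∀ m ≤ n, ∀ t ∈ Icc 0 T, ∀ k, ‖mode v₀ m t k‖ ≤ M := by
  have hM₀' : 0 ≤ M₀ := (norm_nonneg _).trans (hM₀ 0)
  intro n
  induction n with
  | zero =>
    refine ⟨0, le_rfl, fun m hm t _ k => ?_⟩
    rw [Nat.le_zero.1 hm, mode_zero]; simp
  | succ n ih =>
    obtain ⟨M, hM, hb⟩ := ih
    -- bound for the new mode `n + 1`
    have hnew : ∃ B, 0 ≤ B ∧ ∀ t ∈ Icc 0 T, ∀ k, ‖mode v₀ (n + 1) t k‖ ≤ B := by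
      rcases n with _ | m
      · refine ⟨M₀, hM₀', fun t ht k => ?_⟩
        show ‖mode v₀ 1 t k‖ ≤ M₀
        rw [mode_one, norm_smul, Real.norm_eq_abs, abs_of_pos (Real.exp_pos _)]
        have hexp : Real.exp (-t * ‖k‖ ^ 2) ≤ 1 := by
          rw [Real.exp_le_one_iff]; nlinarith [ht.1, sq_nonneg ‖k‖]
        calc Real.exp (-t * ‖k‖ ^ 2) * ‖v₀ k‖ ≤ 1 * M₀ :=
              mul_le_mul hexp (hM₀ k) (norm_nonneg _) zero_le_one
          _ = M₀ := one_mul _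
      · -- `n + 1 = m + 2`: a sum of `m + 1` Duhamel pairs of modes of order `≤ m + 1 = n`
        set ρ : ℝ := (m + 1 : ℕ) * |R| with hρ
        set C : ℝ := |T| * (((m + 2 : ℕ) : ℝ) * |R| * M * (2 * M) * ballVol ρ) with hC
        have hCnn : 0 ≤ C := by have := ballVol_nonneg ρ; positivity
        refine ⟨(m + 1 : ℕ) * C, by positivity, fun t ht k => ?_⟩
        show ‖mode v₀ (m + 2) t k‖ ≤ (m + 1 : ℕ) * C
        by_cases hk : mode v₀ (m + 2) t k = 0
        · rw [hk, norm_zero]; positivity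
        have hks := (mode_support hv₀ (m + 2) t k hk).2
        have hkR : ‖k‖ ≤ ((m + 2 : ℕ) : ℝ) * |R| :=
          hks.trans (mul_le_mul_of_nonneg_left (le_abs_self R) (by positivity))
        rw [mode_add_two]
        calc ‖∑ i : Fin (m + 1), duhamelPair (mode v₀ (i.1 + 1)) (mode v₀ (m - i.1 + 1)) t k‖
            ≤ ∑ i : Fin (m + 1), ‖duhamelPair (mode v₀ (i.1 + 1)) (mode v₀ (m - i.1 + 1)) t k‖ :=
              norm_sum_le _ _
          _ ≤ ∑ _i : Fin (m + 1), C := by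
              refine Finset.sum_le_sum fun i _ => ?_
              have hi2 := i.2
              have hp : i.1 + 1 ≤ m + 1 := by omega
              have hq : m - i.1 + 1 ≤ m + 1 := by omega
              have hGs : ∀ s ∈ Icc 0 T, ∀ k', mode v₀ (m - i.1 + 1) s k' ≠ 0 → ‖k'‖ ≤ ρ := by
                intro s _ k' hk'
                have h := (mode_support hv₀ _ s k' hk').2
                refine h.trans ?_
                rw [hρ]
                calc ((m - i.1 + 1 : ℕ) : ℝ) * R ≤ ((m - i.1 + 1 : ℕ) : ℝ) * |R| :=
                      mul_le_mul_of_nonneg_left (le_abs_self R) (by positivity)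
                  _ ≤ ((m + 1 : ℕ) : ℝ) * |R| := by gcongr
              calc ‖duhamelPair (mode v₀ (i.1 + 1)) (mode v₀ (m - i.1 + 1)) t k‖
                  ≤ T * (‖k‖ * M * (2 * M) * ballVol ρ) :=
                    norm_duhamelPair_le (hb _ hp) (hb _ hq) hGs ht k
                _ ≤ |T| * (((m + 2 : ℕ) : ℝ) * |R| * M * (2 * M) * ballVol ρ) := by
                    have := ballVol_nonneg ρ
                    gcongr
                    exact le_abs_self T
                _ = C := by rw [hC]
          _ = (m + 1 : ℕ) * C := by simp
    obtain ⟨B, hB, hBb⟩ := hnew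
    refine ⟨max M B, le_max_of_le_left hM, fun m hm t ht k => ?_⟩
    rcases Nat.lt_or_eq_of_le hm with hlt | heq
    · exact (hb m (Nat.lt_succ_iff.1 hlt) t ht k).trans (le_max_left _ _)
    · rw [heq]; exact (hBb t ht k).trans (le_max_right _ _)


/-! ### The series solves Li–Sinai's equation (1) pointwise, for all times -/

/-- `x < (⌊x/a⌋₊ + 1) a` for `a > 0`. [folklore] -/
theorem lt_floor_succ_mul {a : ℝ} (ha : 0 < a) (x : ℝ) : x < ((⌊x / a⌋₊ + 1 : ℕ) : ℝ) * a := by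
  have h := Nat.lt_floor_add_one (x / a)
  rw [div_lt_iff₀ ha] at h
  exact_mod_cast h

/-- Each time slice of the series solution of a measurable datum supported in `{k₃ ≥ a > 0}` is
Borel measurable (pointwise limit of the measurable partial sums, which are eventually constant at
each `k`). [folklore] -/
theorem measurable_seriesSolution {v₀ : ℝ³ → ℝ³} {a R : ℝ} (ha : 0 < a) (hv₀m : Measurable v₀)
    (hv₀ : ∀ k, v₀ k ≠ 0 → a ≤ k 2 ∧ ‖k‖ ≤ R) (t : ℝ) : Measurable (seriesSolution v₀ t) := by
  refine measurable_of_tendsto_metrizable (f := fun i k => ∑ p ∈ range i, mode v₀ p t k)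
    (fun i => Finset.measurable_fun_sum _ fun p _ => measurable_mode_slice hv₀m p t) ?_
  rw [tendsto_pi_nhds]
  intro k
  have hs : Summable fun p => mode v₀ p t k :=
    summable_of_ne_finset_zero (s := range (⌊k 2 / a⌋₊ + 1)) fun p hp =>
      mode_eq_zero_of_le ha hv₀ (lt_floor_succ_mul ha (k 2)) (by simpa using hp) t
  exact hs.hasSum.tendsto_sum_nat

/-- Regrouping the full antidiagonal `p + q = i + 2` of Duhamel pairs of modes into the mode of
order `i + 2`: the pairs with `p = 0` or `q = 0` vanish and the rest is the recursion. [cite: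
LiSinai2008, §2 eq. (6) p. 269] -/
theorem sum_antidiagonal_duhamelPair_mode (v₀ : ℝ³ → ℝ³) (i : ℕ) (t : ℝ) (k : ℝ³) :
    ∑ pq ∈ antidiagonal (i + 1 + 1), duhamelPair (mode v₀ pq.1) (mode v₀ pq.2) t k =
      mode v₀ (i + 1 + 1) t k := by
  rw [Nat.sum_antidiagonal_succ, Nat.sum_antidiagonal_succ', mode_add_two_eq_sum_antidiagonal,
    mode_zero, duhamelPair_zero_left, duhamelPair_zero_right, zero_add, zero_add]

/-- The antidiagonal `p + q = 0` contributes nothing (`mode v₀ 0 = 0`). [folklore] -/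
theorem sum_antidiagonal_zero_duhamelPair (v₀ : ℝ³ → ℝ³) (t : ℝ) (k : ℝ³) :
    ∑ pq ∈ antidiagonal 0, duhamelPair (mode v₀ pq.1) (mode v₀ pq.2) t k = 0 := by
  simp [mode_zero, duhamelPair_zero_left]

/-- The antidiagonal `p + q = 1` contributes nothing (`mode v₀ 0 = 0`). [folklore] -/
theorem sum_antidiagonal_one_duhamelPair (v₀ : ℝ³ → ℝ³) (t : ℝ) (k : ℝ³) :
    ∑ pq ∈ antidiagonal 1, duhamelPair (mode v₀ pq.1) (mode v₀ pq.2) t k = 0 := by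
  rw [Nat.sum_antidiagonal_succ]
  simp [mode_zero, duhamelPair_zero_left, duhamelPair_zero_right]

/-- **The power series (3) solves Li–Sinai's equation (1), at every time and every wave vector.**
Let `v₀ : ℝ³ → ℝ³` be measurable, bounded, and vanish off `{a ≤ k₃, |k| ≤ R}` with `a > 0`. Then
`v = seriesSolution v₀` satisfies `SolvesFourierNSAt v τ k` for EVERY `τ ≥ 0` and EVERY `k`: the
`k'`-integrand of (1) is integrable for all `s ∈ (0, τ)`, the Duhamel integrand is interval
integrable on `[0, τ]`, and `v(k,τ) = e^{-τ|k|²} v(k,0) + ∫₀^τ e^{-(τ-s)|k|²} ∫ ⟨v(k-k',s),k⟩ P_k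
v(k',s) dk' ds` exactly. Proof: at `k` only the modes `p < n + 2`, `n = ⌊k₃/a⌋`, are nonzero, and
in the interaction integrand at `k` both factors are such finite sums (or one of them vanishes
identically), so (1) reduces, by bilinearity and finitely many exchanges of finite sums with
integrals, to the recursion defining the modes, regrouped along antidiagonals. The paper
substitutes (3) into (1) formally and invokes [S2] for convergence at small `s`; that the
substitution is exact for all times because all sums are finite at each `k` is a remark of this
file. [cite: LiSinai2008, §2 eqs. (1), (3)–(6) p. 268–270] -/
theorem seriesSolution_solvesFourierNSAt {v₀ : ℝ³ → ℝ³} {a R M₀ : ℝ} (ha : 0 < a)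
    (hv₀m : Measurable v₀) (hv₀ : ∀ k, v₀ k ≠ 0 → a ≤ k 2 ∧ ‖k‖ ≤ R) (hM₀ : ∀ k, ‖v₀ k‖ ≤ M₀)
    {τ : ℝ} (hτ : 0 ≤ τ) (k : ℝ³) : SolvesFourierNSAt (seriesSolution v₀) τ k := by
  set n : ℕ := ⌊k 2 / a⌋₊ with hn
  have hkN : k 2 < ((n + 2 : ℕ) : ℝ) * a :=
    (lt_floor_succ_mul ha (k 2)).trans_le (by gcongr; omega)
  -- the bilinear pieces
  set Φ : ℕ × ℕ → ℝ → ℝ³ → ℝ³ := fun pq => pairIntegrand (mode v₀ pq.1) (mode v₀ pq.2) k with hΦ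
  have hvan : ∀ s k', ∀ p q : ℕ, n + 2 ≤ p + q → Φ (p, q) s k' = 0 := by
    intro s k' p q hpq
    have h := pairIntegrand_eq_zero_of_not (mode_support hv₀ p) (mode_support hv₀ q) (k := k)
      (by
        rintro ⟨h1, -⟩
        have : ((n + 2 : ℕ) : ℝ) * a ≤ (p : ℝ) * a + (q : ℝ) * a := by
          rw [← add_mul]; gcongr; exact_mod_cast hpq
        linarith)
    exact congrFun (congrFun h s) k'
  -- (i) the interaction integrand of the series is a finite sum of bilinear pieces
  have hint : ∀ s k', fourierNSIntegrand (seriesSolution v₀) s k k' =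
      ∑ m ∈ range (n + 2), ∑ pq ∈ antidiagonal m, Φ pq s k' := by
    intro s k'
    refine Eq.trans ?_
      (sum_range_range_eq_sum_antidiagonal (fun pq => Φ pq s k') (n + 2) (hvan s k'))
    show fourierNSIntegrand (seriesSolution v₀) s k k' =
      ∑ p ∈ range (n + 2), ∑ q ∈ range (n + 2), Φ (p, q) s k'
    by_cases hk' : a ≤ k' 2 ∧ a ≤ (k - k') 2
    · have hsub : (k - k') 2 = k 2 - k' 2 := by simp
      have hk'N : k' 2 < ((n + 2 : ℕ) : ℝ) * a := by linarith [hk'.2]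
      have hkk'N : (k - k') 2 < ((n + 2 : ℕ) : ℝ) * a := by linarith [hk'.1]
      rw [fourierNSIntegrand, seriesSolution_eq_sum ha hv₀ hkk'N, seriesSolution_eq_sum ha hv₀ hk'N,
        sum_inner, map_sum, Finset.sum_smul]
      refine Finset.sum_congr rfl fun p _ => ?_
      rw [Finset.smul_sum]
      rfl
    · have hzero : ∀ pq : ℕ × ℕ, Φ pq s k' = 0 := by
        intro pq
        simp only [hΦ, pairIntegrand]
        rcases not_and_or.1 hk' with h | h
        · rw [mode_eq_zero_of_lt_a ha hv₀ (not_le.1 h) pq.2 s]; simp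
        · rw [mode_eq_zero_of_lt_a ha hv₀ (not_le.1 h) pq.1 s]; simp
      have hu0 : fourierNSIntegrand (seriesSolution v₀) s k k' = 0 := by
        unfold fourierNSIntegrand
        rcases not_and_or.1 hk' with h | h
        · rw [seriesSolution_eq_zero ha hv₀ (not_le.1 h) s]; simp
        · rw [seriesSolution_eq_zero ha hv₀ (not_le.1 h) s]; simp
      rw [hu0]
      symm
      exact Finset.sum_eq_zero fun p _ => Finset.sum_eq_zero fun q _ => hzero (p, q)
  -- (ii) uniform bounds and supports of the modes of order `≤ n + 2` on `[0, τ]`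
  obtain ⟨M, -, hb⟩ := mode_bound hv₀ hM₀ τ (n + 2)
  set ρ : ℝ := ((n + 2 : ℕ) : ℝ) * |R| with hρ
  have hGs : ∀ q ≤ n + 2, ∀ s ∈ Icc 0 τ, ∀ k', mode v₀ q s k' ≠ 0 → ‖k'‖ ≤ ρ := by
    intro q hq s _ k' hk'
    refine (mode_support hv₀ q s k' hk').2.trans ?_
    calc (q : ℝ) * R ≤ (q : ℝ) * |R| := mul_le_mul_of_nonneg_left (le_abs_self R) (by positivity)
      _ ≤ ρ := by rw [hρ]; gcongr
  have hle : ∀ m ∈ range (n + 2), ∀ pq ∈ antidiagonal m, pq.1 ≤ n + 2 ∧ pq.2 ≤ n + 2 := by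
    intro m hm pq hpq
    rw [Finset.mem_range] at hm
    rw [mem_antidiagonal] at hpq
    omega
  have hΦint : ∀ s ∈ Icc 0 τ, ∀ m ∈ range (n + 2), ∀ pq ∈ antidiagonal m,
      Integrable (Φ pq s) (volume : Measure ℝ³) := by
    intro s hs m hm pq hpq
    obtain ⟨h1, h2⟩ := hle m hm pq hpq
    exact integrable_pairIntegrand (measurable_mode hv₀m _) (measurable_mode hv₀m _)
      (hb _ h1 s hs) (hb _ h2 s hs) (hGs _ h2 s hs)
  have hΨint : ∀ m ∈ range (n + 2), ∀ pq ∈ antidiagonal m, IntervalIntegrable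
      (fun s => Real.exp (-(τ - s) * ‖k‖ ^ 2) • ∫ k', Φ pq s k') volume 0 τ := by
    intro m hm pq hpq
    obtain ⟨h1, h2⟩ := hle m hm pq hpq
    exact intervalIntegrable_duhamelIntegrand (measurable_mode hv₀m _) (measurable_mode hv₀m _)
      (hb _ h1) (hb _ h2) (hGs _ h2) ⟨hτ, le_rfl⟩ k
  -- (iii) the inner integral, for `s ∈ [0, τ]`
  have hinner : ∀ s ∈ Icc 0 τ, ∫ k', fourierNSIntegrand (seriesSolution v₀) s k k' =
      ∑ m ∈ range (n + 2), ∑ pq ∈ antidiagonal m, ∫ k', Φ pq s k' := by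
    intro s hs
    rw [show (fun k' => fourierNSIntegrand (seriesSolution v₀) s k k') =
        fun k' => ∑ m ∈ range (n + 2), ∑ pq ∈ antidiagonal m, Φ pq s k' from funext (hint s)]
    rw [integral_finsetSum _ fun m hm =>
      integrable_finsetSum _ fun pq hpq => hΦint s hs m hm pq hpq]
    exact Finset.sum_congr rfl fun m hm => integral_finsetSum _ fun pq hpq => hΦint s hs m hm pq hpq
  have hEqOn : EqOn
      (fun s => ∑ m ∈ range (n + 2), ∑ pq ∈ antidiagonal m,
        Real.exp (-(τ - s) * ‖k‖ ^ 2) • ∫ k', Φ pq s k')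
      (fun s => Real.exp (-(τ - s) * ‖k‖ ^ 2) • ∫ k', fourierNSIntegrand (seriesSolution v₀) s k k')
      (Icc 0 τ) := by
    intro s hs
    simp only [hinner s hs, Finset.smul_sum]
  have hsumInt : ∀ m ∈ range (n + 2), IntervalIntegrable
      (fun s => ∑ pq ∈ antidiagonal m, Real.exp (-(τ - s) * ‖k‖ ^ 2) • ∫ k', Φ pq s k')
      volume 0 τ := by
    intro m hm
    have := IntervalIntegrable.sum (μ := volume) (a := 0) (b := τ) (antidiagonal m)
      (f := fun pq s => Real.exp (-(τ - s) * ‖k‖ ^ 2) • ∫ k', Φ pq s k')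
      fun pq hpq => hΨint m hm pq hpq
    simpa only [Finset.sum_fn] using this
  refine ⟨?_, ?_, ?_⟩
  · -- clause 1: integrability of the interaction integrand
    intro s hs
    rw [show fourierNSIntegrand (seriesSolution v₀) s k =
        fun k' => ∑ m ∈ range (n + 2), ∑ pq ∈ antidiagonal m, Φ pq s k' from funext (hint s)]
    exact integrable_finsetSum _ fun m hm => integrable_finsetSum _ fun pq hpq =>
      hΦint s ⟨hs.1.le, hs.2.le⟩ m hm pq hpq
  · -- clause 2: interval integrability of the Duhamel integrand
    refine (intervalIntegrable_congr (hEqOn.mono ?_)).1 ?_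
    · rw [uIoc_of_le hτ]; exact Ioc_subset_Icc_self
    · have := IntervalIntegrable.sum (μ := volume) (a := 0) (b := τ) (range (n + 2))
        (f := fun m s => ∑ pq ∈ antidiagonal m, Real.exp (-(τ - s) * ‖k‖ ^ 2) • ∫ k', Φ pq s k')
        hsumInt
      simpa only [Finset.sum_fn] using this
  · -- clause 3: the identity (1)
    have hEqOn' : EqOn
        (fun s => ∑ m ∈ range (n + 2), ∑ pq ∈ antidiagonal m,
          Real.exp (-(τ - s) * ‖k‖ ^ 2) • ∫ k', Φ pq s k')
        (fun s => Real.exp (-(τ - s) * ‖k‖ ^ 2) •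
          ∫ k', fourierNSIntegrand (seriesSolution v₀) s k k')
        (uIcc 0 τ) := by
      rwa [uIcc_of_le hτ]
    have hI : ∫ s in (0 : ℝ)..τ, Real.exp (-(τ - s) * ‖k‖ ^ 2) •
        ∫ k', fourierNSIntegrand (seriesSolution v₀) s k k' =
        ∑ m ∈ range (n + 2), ∑ pq ∈ antidiagonal m,
          duhamelPair (mode v₀ pq.1) (mode v₀ pq.2) τ k := by
      rw [← intervalIntegral.integral_congr hEqOn', intervalIntegral.integral_finsetSum hsumInt]
      refine Finset.sum_congr rfl fun m hm => ?_
      rw [intervalIntegral.integral_finsetSum fun pq hpq => hΨint m hm pq hpq]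
      rfl
    rw [hI, seriesSolution_zero, seriesSolution_eq_sum ha hv₀ hkN τ, Finset.sum_range_succ',
      Finset.sum_range_succ', Finset.sum_range_succ', Finset.sum_range_succ']
    simp only [zero_add, sum_antidiagonal_duhamelPair_mode, sum_antidiagonal_zero_duhamelPair,
      sum_antidiagonal_one_duhamelPair, mode_zero, mode_one, add_zero]
    rw [add_comm]


/-! ### Scaling in the amplitude and incompressibility -/

/-- The interaction integrand is homogeneous in the first field. [folklore] -/
theorem pairIntegrand_smul_left (c : ℝ) (F G : ℝ → ℝ³ → ℝ³) (k : ℝ³) :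
    pairIntegrand (fun s k => c • F s k) G k = fun s k' => c • pairIntegrand F G k s k' := by
  funext s k'
  simp only [pairIntegrand, real_inner_smul_left, smul_smul]

/-- The interaction integrand is homogeneous in the second field. [folklore] -/
theorem pairIntegrand_smul_right (c : ℝ) (F G : ℝ → ℝ³ → ℝ³) (k : ℝ³) :
    pairIntegrand F (fun s k => c • G s k) k = fun s k' => c • pairIntegrand F G k s k' := by
  funext s k'
  simp only [pairIntegrand, map_smul, smul_smul, mul_comm c]

/-- The Duhamel pair is homogeneous in the first field (no integrability needed: `∫ c • f = c • ∫ f`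
unconditionally). [folklore] -/
theorem duhamelPair_smul_left (c : ℝ) (F G : ℝ → ℝ³ → ℝ³) (t : ℝ) (k : ℝ³) :
    duhamelPair (fun s k => c • F s k) G t k = c • duhamelPair F G t k := by
  simp only [duhamelPair, pairIntegrand_smul_left, integral_smul, smul_comm _ c,
    intervalIntegral.integral_smul]

/-- The Duhamel pair is homogeneous in the second field. [folklore] -/
theorem duhamelPair_smul_right (c : ℝ) (F G : ℝ → ℝ³ → ℝ³) (t : ℝ) (k : ℝ³) :
    duhamelPair F (fun s k => c • G s k) t k = c • duhamelPair F G t k := by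
  simp only [duhamelPair, pairIntegrand_smul_right, integral_smul, smul_comm _ c,
    intervalIntegral.integral_smul]

/-- **Modes scale like powers of the amplitude**: `mode (A • v₀) p = A^p • mode v₀ p`, so the series
of the one-parameter family `v_A(k,0) = A v(k,0)` is the power series `Σ_p A^p · mode v₀ p` of
(3)/(46). [cite: LiSinai2008, §2 eq. (3) p. 269] -/
theorem mode_smul (A : ℝ) (v₀ : ℝ³ → ℝ³) :
    ∀ p, mode (fun k => A • v₀ k) p = fun t k => A ^ p • mode v₀ p t k := by
  intro p
  induction p using Nat.strong_induction_on with
  | _ p ih =>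
  rcases p with _ | _ | m
  · funext t k; simp [mode_zero]
  · show mode (fun k => A • v₀ k) 1 = fun t k => A ^ 1 • mode v₀ 1 t k
    funext t k; rw [mode_one, mode_one, pow_one, smul_comm]
  · show mode (fun k => A • v₀ k) (m + 2) = fun t k => A ^ (m + 2) • mode v₀ (m + 2) t k
    funext t k
    rw [mode_add_two, mode_add_two, Finset.smul_sum]
    refine Finset.sum_congr rfl fun i _ => ?_
    have hi2 := i.2
    rw [ih _ (by omega), ih _ (by omega), duhamelPair_smul_left, duhamelPair_smul_right, smul_smul,
      ← pow_add]
    congr 2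
    omega

/-- The series of the scaled datum is the power series in the amplitude: `seriesSolution (A • v₀)
t k = Σ' p, A^p • mode v₀ p t k` (eq. (3) of §2, eq. (46) of §10, with `mode v₀ p t k = ∫₀ᵗ
e^{-(t-s)|k|²} g_p(k,s) ds` for `p ≥ 2`). [cite: LiSinai2008, §10 eq. (46) p. 312] -/
theorem seriesSolution_smul (A : ℝ) (v₀ : ℝ³ → ℝ³) (t : ℝ) (k : ℝ³) :
    seriesSolution (fun k => A • v₀ k) t k = ∑' p, A ^ p • mode v₀ p t k := by
  unfold seriesSolution
  exact tsum_congr fun p => by rw [mode_smul]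

/-- The interaction integrand is orthogonal to the wave vector: `⟨k, ⟨F,k⟩ P_k G⟩ = 0` (for `k ≠ 0`
because `P_k` projects onto `k^⊥`, for `k = 0` trivially). [cite: LiSinai2008, §2 p. 269] -/
theorem inner_pairIntegrand (F G : ℝ → ℝ³ → ℝ³) (k : ℝ³) (s : ℝ) (k' : ℝ³) :
    ⟪k, pairIntegrand F G k s k'⟫ = 0 := by
  unfold pairIntegrand
  rw [real_inner_smul_right, leraySymbol_apply, inner_sub_right, real_inner_smul_right,
    real_inner_smul_right, real_inner_self_eq_norm_sq]
  by_cases hk : k = 0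
  · simp [hk]
  · have : ‖k‖ ^ 2 ≠ 0 := pow_ne_zero 2 (norm_ne_zero_iff.2 hk)
    field_simp
    ring

/-- The `k'`-integral of the interaction integrand is orthogonal to `k` (whether or not the
integrand is integrable: the junk value `0` is orthogonal too). [cite: LiSinai2008, §2 p. 269] -/
theorem inner_integral_pairIntegrand (F G : ℝ → ℝ³ → ℝ³) (k : ℝ³) (s : ℝ) :
    ⟪k, ∫ k', pairIntegrand F G k s k'⟫ = 0 := by
  by_cases hi : Integrable (pairIntegrand F G k s) (volume : Measure ℝ³)
  · rw [← integral_inner hi]; simp [inner_pairIntegrand]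
  · rw [integral_undef hi, inner_zero_right]

/-- Duhamel pairs are orthogonal to the wave vector, `⟨duhamelPair F G t k, k⟩ = 0` ("Clearly,
`g_p(k,s) ⊥ k`"), unconditionally (junk integrals are `0`). [cite: LiSinai2008, §2 p. 269] -/
theorem inner_duhamelPair (F G : ℝ → ℝ³ → ℝ³) (t : ℝ) (k : ℝ³) :
    ⟪duhamelPair F G t k, k⟫ = 0 := by
  rw [real_inner_comm, duhamelPair]
  by_cases hi : IntervalIntegrable
      (fun s => Real.exp (-(t - s) * ‖k‖ ^ 2) • ∫ k', pairIntegrand F G k s k') volume 0 t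
  · have h := (innerSL ℝ k).intervalIntegral_comp_comm hi
    rw [innerSL_apply_apply] at h
    rw [← h]
    simp [innerSL_apply_apply, inner_integral_pairIntegrand]
  · rw [intervalIntegral.integral_undef hi, inner_zero_right]

/-- Every mode is orthogonal to `k` if the datum is incompressible (`⟨v₀(k), k⟩ = 0`); for `p ≥ 2`
this needs no hypothesis. [cite: LiSinai2008, §2 p. 269] -/
theorem inner_mode {v₀ : ℝ³ → ℝ³} (hdiv : ∀ k, ⟪v₀ k, k⟫ = 0) (p : ℕ) (t : ℝ) (k : ℝ³) :
    ⟪mode v₀ p t k, k⟫ = 0 := by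
  rcases p with _ | _ | m
  · simp [mode_zero]
  · show ⟪mode v₀ 1 t k, k⟫ = 0
    rw [mode_one, real_inner_smul_left, hdiv, mul_zero]
  · show ⟪mode v₀ (m + 2) t k, k⟫ = 0
    rw [mode_add_two, sum_inner]
    exact Finset.sum_eq_zero fun i _ => inner_duhamelPair _ _ _ _

/-- **Incompressibility of the series solution**: `⟨seriesSolution v₀ t k, k⟩ = 0` for an
incompressible datum, at every `t` and `k` (if the series is not summable at `k` its junk value
`0` is orthogonal as well). [cite: LiSinai2008, §1 p. 268 and §2 p. 269] -/
theorem inner_seriesSolution {v₀ : ℝ³ → ℝ³} (hdiv : ∀ k, ⟪v₀ k, k⟫ = 0) (t : ℝ) (k : ℝ³) :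
    ⟪seriesSolution v₀ t k, k⟫ = 0 := by
  unfold seriesSolution
  by_cases hs : Summable fun p => mode v₀ p t k
  · have h := ((innerSL ℝ k).hasSum hs.hasSum).tsum_eq
    simp only [innerSL_apply_apply] at h
    rw [real_inner_comm, ← h]
    have h0 : ∀ p, ⟪k, mode v₀ p t k⟫ = 0 := fun p => by
      rw [real_inner_comm]; exact inner_mode hdiv p t k
    simp [h0]
  · rw [tsum_eq_zero_of_not_summable hs, inner_zero_left]

end LiSinai

open LiSinai

/-- **Li–Sinai 2008, the energy profile of the power-series solution — the unproved core of the
barrier `ComplexNavierStokesBlowup`.** There exist a real Fourier datum `v₀ : ℝ³ → ℝ³` that is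
measurable, bounded, vanishes off a compact slab piece `{a ≤ k₃, |k| ≤ R}` with `a > 0`
(Li–Sinai: a bounded function supported in a neighbourhood of `(0, 0, k⁽⁰⁾)`, `k⁽⁰⁾` large —
the datum (39) of §7 with the parameter values `b(t)` of Theorem 1, multiplied by the critical
amplitude `A_cr(t) = Λ(t)⁻¹` of §10) and is incompressible (`⟨v₀(k), k⟩ = 0`), and a time `t > 0`,
such that the power-series solution `v = seriesSolution v₀` — which by
`LiSinai.seriesSolution_solvesFourierNSAt` solves (1) at every time, and by
`LiSinai.seriesSolution_smul` is the series (46) — has finite energy `∫ |v(k,τ)|² dk < ∞` for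
every `τ ∈ [0, t)` and infinite energy at `τ = t`. In print: "Put `A_cr(t) = Λ(t)⁻¹`. If so then
`A^p g_p(k,t)` is concentrated in the domain … having the size `O(√p)` and there it takes values
`O(p)`. This immediately implies that at `t` the energy is infinite. … Therefore for `t' < t` both
the energy and the enstrophy are finite" (§10 p. 312), resting on Theorem 1 (p. 311). PROVED
here: this fact implies `LiSinaiCriticalEnergyBlowup` and `ComplexNavierStokesBlowup`; NOT proved:
the fact (see the audit in `ComplexNavierStokesBlowupProofs.lean` for what Theorem 1 covers).
[cite: LiSinai2008, Thm. 1 p. 311 and §10 p. 312]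

BARRIER (structured block, D-0021):
- technique_class: complexification-insensitive fourier-side-algebra energy-sign-blind real-structure-insensitive formal-perturbation-series power-series-in-data
- blocks: NavierStokesRegularity (`Literature.NS.NavierStokesExistenceSmoothR3`) by any argument insensitive to the real-valuedness of `u` (see `ComplexNavierStokesBlowup`): for the explicit all-time pointwise solution `seriesSolution v₀` of (1) (`LiSinai.seriesSolution_solvesFourierNSAt`) the energy is finite before `t` and infinite at `t` [cite: LiSinai2008, Thm. 1 p. 311 and §10 p. 312].
- because: the modes `A^p g_p` of the power series (3) are supported in `C + ⋯ + C` around `p κ⁽⁰⁾` [cite: LiSinai2008, §2 p. 270]; after the `√p`-rescaling the recursion (7) is a renormalisation-group map with a Gaussian–Hermite fixed point, and for data tuned to its stable manifold `g̃_p(Y,s) = p Z(s) Λ(s)^p e^{-|Y|²/2}(H⁽⁰⁾ + o(1))`, `Λ` strictly increasing [cite: LiSinai2008, Thm. 1 p. 311]; at `A = Λ(t)⁻¹` the modes at time `t` have size `O(p)` on balls of size `O(√p)`, so the energy at `t` diverges [cite: LiSinai2008, §10 p. 312].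
- evasions_known: use real-valuedness / the two-sidedness of the spectrum of a real field — the data here live in `{k₃ ≥ a > 0}`, impossible for a real `u` [cite: LiSinai2008, §1 p. 268–269]; see `ComplexNavierStokesBlowup` and `LiSinaiCriticalEnergyBlowupNarrow` for the cited discussion (Tao 2016 §1.1; Boldrighini et al. 2020).
- scope_caveats: (a) this is a DECOMPOSITION fact: the solution property of the series is proved in this file, only the energy profile is asserted; (b) "finite at every `τ < t`" records the printed sentence of §10, argued informally there, while Theorem 1 is stated for `s`-dependent parameter values [cite: LiSinai2008, Thm. 1 p. 311 and §10 p. 312] — see the audit in `ComplexNavierStokesBlowupProofs.lean`; (c) computer-numerical steps without stated error control inside the proof of Theorem 1 (`N = 50` initial steps, choice of `ρ₁`) [cite: LiSinai2008, §7 p. 302]; (d) the data class `{a ≤ k₃, |k| ≤ R}`, bounded measurable, contains the printed data (39) (a Gaussian times a non-vanishing factor on the ball `A₁` around `κ⁽⁰⁾ = (0,0,k⁽⁰⁾)`, zero outside) [cite: LiSinai2008, §7 p. 295]; (e) Fourier side only, normalisation of (1) as printed [cite: LiSinai2008, §1 p. 268].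
- status: established in the sense of the source (Theorem 1 with caveat (c) plus the inference of §10); not discharged here. -/
def LiSinaiSeriesEnergyBlowup : Prop :=
  ∃ (v₀ : ℝ³ → ℝ³) (a R t : ℝ), 0 < a ∧ 0 < t ∧
    Measurable v₀ ∧ (∃ M : ℝ, ∀ k, ‖v₀ k‖ ≤ M) ∧ (∀ k, v₀ k ≠ 0 → a ≤ k 2 ∧ ‖k‖ ≤ R) ∧
    (∀ k, ⟪v₀ k, k⟫ = 0) ∧
    (∀ τ ∈ Ico 0 t, ∫⁻ k, ‖seriesSolution v₀ τ k‖ₑ ^ 2 < ∞) ∧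
    ∫⁻ k, ‖seriesSolution v₀ t k‖ₑ ^ 2 = ∞

/-- **The core fact implies the literal Li–Sinai statement** `LiSinaiCriticalEnergyBlowup`: the
series solution has the datum as initial value (`seriesSolution_zero`), compact support of the
datum comes from `|k| ≤ R`, equation (1) on `[0, t]` is `seriesSolution_solvesFourierNSAt`, and
the slices are measurable (`measurable_seriesSolution`). [folklore] -/
theorem LiSinaiSeriesEnergyBlowup.criticalEnergyBlowup (h : LiSinaiSeriesEnergyBlowup) :
    LiSinaiCriticalEnergyBlowup := by
  obtain ⟨v₀, a, R, t, ha, ht, hm, ⟨M₀, hM₀⟩, hsupp, hdiv, hfin, hinf⟩ := h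
  refine ⟨v₀, t, seriesSolution v₀, ht, hm, ?_, ⟨M₀, hM₀⟩, hdiv, seriesSolution_zero v₀, ?_, ?_,
    hinf⟩
  · refine HasCompactSupport.intro (isCompact_closedBall (0 : ℝ³) R) fun k hk => ?_
    by_contra h
    exact hk (mem_closedBall_zero_iff.2 (hsupp k h).2)
  · intro τ hτ k _
    exact seriesSolution_solvesFourierNSAt ha hm hsupp hM₀ hτ.1 k
  · intro τ hτ
    exact ⟨(measurable_seriesSolution ha hm hsupp τ).aemeasurable, hfin τ hτ⟩

/-- **The core fact implies the catalogue barrier fact** `ComplexNavierStokesBlowup` (via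
`LiSinaiCriticalEnergyBlowup.complexNavierStokesBlowup`, the Fatou step). With
`LiSinaiSeriesEnergyBlowup` proved this would be `ComplexNavierStokesBlowup_holds`; it is not
(Theorem 1 of the source is a renormalisation-group construction with computer-numerical steps, §7
p. 302). [folklore] -/
theorem LiSinaiSeriesEnergyBlowup.complexNavierStokesBlowup (h : LiSinaiSeriesEnergyBlowup) :
    ComplexNavierStokesBlowup :=
  h.criticalEnergyBlowup.complexNavierStokesBlowup

end Literature.Barriers.NavierStokesRegularity
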